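import Mathlib
import HarnessLib
import HarnessLib.Audit
import Summits.Langlands.Statement
import Literature.NumberTheory.GaloisRepresentations.LocalGaloisGroupFrobeniusProofs
import Literature.NumberTheory.Automorphic.LocalConstantsProofs
import Literature.NumberTheory.Automorphic.LocalLanglandsGLProofs
import HarnessLib.Audit.Status.Attr

/-!
Route: BaseFieldAscent

Route BaseFieldAscent — "the number field is not the variable" (realises idea card
conjugation-solvable-fields).

It suffices to show X = X₁ ∧ X₂ ∧ X₃ where
 X₁ (ReciprocityTRCM): the summit restricted to totally real and CM base fields (both directions,
all n, ALL weights — this is where every engine lives and where the irregular core must be won);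
 X₂ (AscentConjugationSolvable): reciprocity over TR∪CM ⇒ reciprocity over every
CONJUGATION-SOLVABLE field F (F lies in a solvable Galois extension E of a totally real field F₀;
equivalently the Galois closure of F over its maximal totally real subfield is solvable: TR, CM,
every quadratic extension of a TR field, pure cubics, every F with [F:F^tr] ≤ 4) — by Arthur–Clozel
automorphic induction/base change along cyclic prime layers, Clifford theory and Sorensen-type
patching over twists (up-steps), cyclic descent (down-steps), with the TR∪CM input consumed in
IRREGULAR weight (strong purity makes every induced object Hodge-irregular);
 X₃ (AscentResidual): reciprocity over conjugation-solvable fields ⇒ reciprocity over all number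
fields — the residual class (insoluble conjugation-closure) is exactly one functoriality away: base
change / automorphic induction / descent for GL_n along Galois extensions with simple non-abelian
group.
Support (theorem-level): ReciprocityCMtoTR (CM ⇒ TR by Sorensen patching + quadratic descent of
automorphy), QuadraticAscentAutToGal (the first up-rung in every rank: (A) over TR F₀, all weights ⇒
(A) over any quadratic F/F₀ — Taylor 1994 / Mok / BCGP §2.7 de-induction generalised).

One-line Lean Prop (decls of Summits/Langlands/Langlands/Theses/BaseFieldAscent.lean; elaborated in
Sketch.lean, rc 0):
X := BaseFieldAscent.ReciprocityTRCM ∧ BaseFieldAscent.AscentConjugationSolvable ∧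
BaseFieldAscent.AscentResidual,
where conjugation-solvability of F is typed inline as ∃ (F₀ E : Type) [fields, NumberField] [Algebra
F₀ F] [Algebra F E] [Algebra F₀ E] [IsScalarTower F₀ F E] [IsGalois F₀ E], NumberField.IsTotallyReal
F₀ ∧ IsSolvable (E ≃ₐ[F₀] E); constants: Summit.Langlands.{ReciprocityData,
GlobalLanglandsCorrespondenceGLn, AutomorphicToGalois},
Literature.NumberTheory.Automorphic.isCompact_glFiniteIntegralLevel, Mathlib
NumberField.IsTotallyReal / NumberField.IsCMField / IsGalois / IsSolvable / IsScalarTower /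
Module.finrank.
Assembly: ReciprocityTRCM → AscentConjugationSolvable → AscentResidual → Langlands (two modus
ponens; sketch proof compiles).

Rationale: WHY THIS LINE. The summit quantifies over ALL number fields, but every construction of Galois
representations and every automorphy-lifting theorem lives over totally real or CM fields, and no
finite extension of a mixed-signature field is CM (subfields of CM fields are TR or CM). The only
bridge to the known world is DOWNWARD: restriction of scalars / automorphic induction to the maximal
totally real subfield F^tr. The idea card conjugation-solvable-fields (refuter novelty audit
2026-08-15: new-combination) classifies base fields by the position of complex conjugation in the
Galois closure: central (TR/CM, known world), solvably generated (reachable by Arthur–Clozel cyclic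
layers + Clifford bookkeeping), or generating an insoluble section (needs exactly simple-group base
change). This route records that classification as two ascent cruxes on top of the TR∪CM core, so
that (a) the bookkeeping theorems (up-steps: Taylor 1994 / Berger–Harcos / Mok / BCGP §2.7
de-induction; down-steps: cyclic descent) can be proved against the tree's Arthur–Clozel and
Sorensen facts, and (b) the genuinely open residues — the inert-place twist ambiguity of NON-NORMAL
solvable descent (Arthur–Clozel Ch.3 closing remark; Rajan MRL 2002 Thms 1–2) and simple-group
functoriality (Getz) — are what gets staffed. Imported area: finite group theory / Clifford theory
on the normal subgroup generated by complex conjugations, trace-formula base change. Adopted from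
the card; what this route adds: the all-n quadratic rung and the CM⇒TR step as typed theorem-level
support, the inline Lean typing of conjugation-solvability, and the explicit statement that the
TR∪CM input is consumed in irregular weight (refuter's correctness point (2): strong purity, Clozel
1990 Lem. 4.9 / Raghuram arXiv:2207.03393 Prop. 2.6). Sources: ArthurClozelAMS120 Ch.3 (Thms 4.2,
5.1, 6.2, Prop 7.2), Sorensen2020, Taylor1994, HarrisSoudryTaylor1993, BoxerEtAl2021 §2.7 and Thm 4,
doi:10.4310/mrl.2002.v9.n4.a9 (Rajan), Getz2012Nonsolvable, GetzHahn2024 §13.4–13.5, Calegari2023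
fn. 57, Goldring2016 §4.4.3.

RANKED CRUXES. #2 ReciprocityTRCM — the summit over TR∪CM (all weights; contains the irregular core;
decomposed by routes LiftDescend/CMFern). #3 AscentConjugationSolvable — TR∪CM ⇒
conjugation-solvable F (bookkeeping theorem for up-steps; open residue: non-normal solvable descent
at inert places, n ≥ 2 beyond cubic GL_2). #4 AscentResidual — conjugation-solvable ⇒ all F
(simple-group BC/AI/descent for GL_n; open even for n = 1). Support: ReciprocityCMtoTR,
QuadraticAscentAutToGal (rank 9). Assembly rank 1.

KILL CRITERIA. #3 is implied by the summit, so it cannot be refuted alone; it is ABANDONED (route →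
dormant) if a prover's census shows the down-step ambiguity needs (B) over the lower field in an
essential way for n = 2 (then the ascent is not bookkeeping and the card's thesis is false as a
reduction; the content moves to LiftDescend.DescentOfAutomorphy). #4: if simple-group base change
for GL_1 along an A₅-quintic is shown to be equivalent to the full strong Artin conjecture for the
induced 5-dimensional monomial representations with no reduction in difficulty, #4 is merely a
renaming and the route should be closed `superseded` by LiftDescend.

NOT DECOMPOSED YET. The card's N1 (extraction at inert places), N2 (Jordan–Hölder matching of
isobaric sums for direction (B) across a cyclic layer), N3 (weight collision / Harris tensor trick)
— they become ≤ 3 glued children of #3 once QuadraticAscentAutToGal or a cubic instance closes; a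
Literature predicate for non-cyclic base change / automorphic induction (definition request filed)
is needed before #4's functoriality hypotheses can be typed as separate items.

NOVELTY (summary; full text in the Novelty field): adopted card conjugation-solvable-fields
(new-combination per audit); nearest printed prior art BoxerEtAl2021 §2.7/Thm 4 (n = 2, any
quadratic over TR), Taylor1994, Rajan 2002; delta = all-n typed reduction with the open residues
isolated. BARRIERS (summary): ShimuraVarietyRealization evaded by relocation to F^tr;
NonRegularWeight bites on #2 (not evaded); SolvableImage(+Narrow) = #4 and the down-steps of #3 (not
evaded, named); TwistedEndoscopy not met (Arthur–Clozel layers); patching/ℓ = p/residual barriers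
not engaged (TR∪CM methods consumed as a black box inside #2); Shtuka not engaged.

Novelty: NOVELTY (survey 2026-08-15). This route ADOPTS the idea card
Langlands/Langlands/conjugation-solvable-fields (planner-ideate-6; refuter novelty audit
2026-08-15T05:22Z graded new-combination, with correctness caveats that are built into this route's
crux texts). Searches actually available this session: `lit frontier Langlands --since 2021` (read;
no descendant treats reciprocity over non-TR/CM fields beyond quadratic-over-TR), the barrier
catalogue (13 entries), `lean search` over the tree (exists_baseChange_cyclic;
ArthurClozel1989_weakLifting_cuspidal / _inducedLift_of_twist_eq / _cuspidal_descent /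
_fibres_of_baseChange; automorphicInduction_character (n = 1 only); PatchingLemma/SorensenPatching
proved; HarrisLanTaylorThorneThm713/Cor627), and the card audits; `lit search`/`lit vsearch`/`lit
galaxy` UNAVAILABLE all session (rc 75, retried) — the card's auditor ran zbMATH ×6, hybrid ×2,
galaxy ×3 on exactly this question and found nothing beyond quadratic-over-TR; the refuter of this
route should re-run "automorphic induction Galois representations mixed signature", "non-normal
cubic base change descent GL(n)", "Rajan image fibres solvable base change".
Nearest prior art (by id): BoxerEtAl2021 §2.7 ("Galois representations for GL_2 over a quadratic
extension of a totally real field", essentially Mok's proof) and Thm 4 (genus-one curves over ANY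
quadratic extension of a TR field, e.g. ℚ(2^{1/4}), potentially modular) — direction (A)/(potential
B), n = 2, weight 0; Taylor199  [refs: 10.1112/s0010437x13007665, 10.4310/mrl.2002.v9.n4.a9, doi:10.1112/s0010437x13007665, doi:10.4310/mrl.2002.v9.n4.a9, BoxerEtAl2021, Taylor1994, HarrisSoudryTaylor1993, Sorensen2020, GetzHahn2024, Calegari2023]

Barriers (technique_class: cyclic-base-change automorphic-induction clifford-theory): BARRIERS (technique_class: cyclic-base-change automorphic-induction clifford-theory patching; all 13
catalogued Langlands entries checked):
- Literature.Barriers.Langlands.ShimuraVarietyRealizationBarrier: applies head-on to every F neither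
TR nor CM; EVADED by relocation — nothing is realised over F; π is induced to the totally real F^tr
where the barrier's own evasions (HLTT, Scholze) live, and ρ_π is recovered by Clifford theory; for
the insoluble residual class the route does not evade it but converts it into the functoriality crux
AscentResidual.
- Literature.Barriers.Langlands.NonRegularWeightBarrier: BITES on ReciprocityTRCM through the
weight-collision phenomenon (strong purity: AI_{F/F₁}(π) has every Hodge–Tate value with
multiplicity ≥ [F:F₁] ≥ 2 for every non-TR/CM F), so the TR∪CM input is needed in irregular weight;
NOT evaded — this is the route's honest dependence on the irregular core (attacked in routes
LiftDescend/CMFern); the barrier's coherent-cohomology evasion (limits of discrete series: BCGP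
weight (2,2) via higher Hida theory) is exactly why the n = 2 quadratic rung is a theorem.
- Literature.Barriers.Langlands.SolvableImageBarrier and
Literature.Barriers.Langlands.SolvableImageBarrierNarrow: these ARE crux AscentResidual
(simple-group BC/AI/descent) and the down-steps of AscentConjugationSolvable (the Narrow file's gap:
non-normal layers of degree 5/6/12 inside an A₅-closure; non-normal cubic descent); not evaded — the
route's bet is that they are the

Novelty grade: new-combination — ROUTE REVIEW (refuter 40af5994, 2026-08-15). VERDICT: sound, keep open. ELAB: all 6 bodies rc0 verbatim under the route's imports (probe V_lang.lean, clean, canary-validated; module farm-unbuilt rc75 all session); Assembly PROVED (two modus ponens, evidence on 1098); 1094's hypothesis = 1093 verbati (refuter refuter-rreview-route-HubbardSuperconduc-40af5994-0, 2026-08-15T11:16:39Z; prior: BoxerEtAl2021 §2.7 / Thm 4 (n=2, any quadratic extension of a TR field), Taylor1994 (de-induction by twists), doi:10.4310/mrl.2002.v9.n4.a9 (Rajan 2002: image and fibres of solvable base change), ArthurClozelAMS120 Ch.3 (cyclic prime-degree BC/AI/descent), Sorensen2020 (patching), Getz2012Nonsolvable / GetzHahn2024 §13.4–13.5)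

History (route lifecycle, newest last):
- 2026-08-27T15:10:19Z · STALE-VERDICT (tier-A confirmation): L236: Type mismatch   h₃ (h₂ h₁) has type   ∀ (F : Type) [inst : Field F] [inst_1 : NumberField F],     ∃ R,       ∀ (n : ℕ),         0 < n →           ∀ (hcpt (operator:gate5)

sub-problem: Langlands · status: draft · opened planner-plan-Langlands-0 2026-08-15T10:50:51Z · rev 4 · ledger route-Langlands-BaseFieldAscent
GENERATED by the gate from the ledger (D-0016/17). Provers cite these decls: `theorem foo : Summit.Langlands.Langlands.Theses.BaseFieldAscent.<Decl> := …` in Summits/Langlands/Langlands/Theorems/<Name>.lean.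
-/

namespace Summit.Langlands.Langlands.Theses.BaseFieldAscent

open scoped BigOperators Topology Manifold Classical MeasureTheory ProbabilityTheory Matrix InnerProductSpace ComplexConjugate ContinuousMap
open Filter Set Function TopologicalSpace MeasureTheory

attribute [summit_statement] _root_.Langlands

/-- item stmt-Langlands-1093 · crux · rank 2 · open · by planner
why it might fail: Open irregular core (Maass λ=1/4, weight-one-type π; even/Hodge-irregular ρ: NonRegularWeightBarrier, Calegari2023 §12). FALSE as typed (∀ ℓ ι) should BG Conj. 3.1.5 fail via an L-algebraic π with a non-algebraic Satake parameter: no ρ_{π,ι} for generic ι (Frobenius eigenvalues are ℓ-adic units).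
sources: BuzzardGeeLMS2014 Conj. 3.1.5, 3.2.1-3.2.2 (PDF p.13-15), Calegari2023 §12, Scholze2015 §1, ACCGHLNSTT2023, HarrisLanTaylorThorneRMS2016 Thm. A, Literature.Barriers.Langlands.NonRegularWeightBarrier
[crux] The summit restricted to totally real and CM base fields: ∀ F, IsTotallyReal F ∨ IsCMField F
→ ∃R ∀n>0 ∀hcpt, GlobalLanglandsCorrespondenceGLn n F R hcpt (both directions, ALL weights, full
local–global compatibility). Every known engine lives here (HLTT/Scholze/Varma for regular (A);
CHT/BLGGT/ACC+GHLNSTT for (B)); the open content is the irregular core (Galois representations for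
Maass λ=1/4-type and rank-n weight-one-type π; automorphy of Hodge-irregular geometric ρ: even Artin
ρ, abelian varieties of dimension ≥3) plus residual automorphy and LGC fine print. Decomposed
further by routes LiftDescend ((A)_CM, potential automorphy, descent) and CMFern (fern density,
classicality). -/
@[route_item "route-Langlands-BaseFieldAscent", crux]
def ReciprocityTRCM : Prop :=
  ∀ (F : Type) [Field F] [NumberField F], (NumberField.IsTotallyReal F ∨ NumberField.IsCMField F) → ∃ R : ReciprocityData F, ∀ n : ℕ, 0 < n → ∀ hcpt : Literature.NumberTheory.Automorphic.isCompact_glFiniteIntegralLevel n F, GlobalLanglandsCorrespondenceGLn n F R hcpt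

/-- item stmt-Langlands-1094 · crux · rank 3 · open · by planner
why it might fail: Non-normal layers (pure cubics…) need non-normal solvable BC/descent: the twist/extension ambiguity at non-split places is not resolvable without reciprocity over an intermediate non-TR/CM field (circular). Known for cubic GL_2 only (JPSS; image/fibres subtle: Lapid–Rogawski, Rajan); AC p.191.
sources: ArthurClozelAMS120 Ch.3 Thm 4.2, Thm 6.2, §7 closing remark (PDF p.191), doi:10.4310/mrl.2002.v9.n4.a9 (Rajan 2002, Thms 1-2), doi:10.1515/form.10.2.175 (Lapid-Rogawski 1998), zbl:1025.11013 (Rajan 2000, non-normal cubic lift), JPSS1981Cubique, Taylor1994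
[crux] Reciprocity over TR∪CM ⇒ reciprocity over every CONJUGATION-SOLVABLE F (typed inline: ∃
totally real F₀ and a finite Galois E ⊇ F ⊇ F₀ with IsSolvable (E ≃ₐ[F₀] E); equivalently the Galois
closure of F over its maximal totally real subfield is solvable — TR, CM, any quadratic extension of
a TR field, pure cubics, every F with [F:F^tr] ≤ 4). Mechanism (card conjugation-solvable-fields,
T_α): UP-steps along cyclic prime layers by Arthur–Clozel AI/BC (tree: exists_baseChange_cyclic,
ArthurClozel1989_inducedLift_of_twist_eq, _fibres_of_baseChange) + Clifford theory + de-induction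
over a Zariski-dense family of twists π⊗χ (Taylor1994, Mok, BCGP §2.7: n=2 any quadratic over TR),
DOWN-steps by cyclic descent (ArthurClozel1989_cuspidal_descent); direction (B) by Jordan–Hölder
matching of isobaric sums across layers using the lower field's reciprocity + AC 4.2(b). The TR∪CM
input is consumed in IRREGULAR weight (strong purity: every induced object over F₁ is
Hodge-irregular). -/
@[route_item "route-Langlands-BaseFieldAscent", crux]
def AscentConjugationSolvable : Prop :=
  (∀ (F : Type) [Field F] [NumberField F], (NumberField.IsTotallyReal F ∨ NumberField.IsCMField F) → ∃ R : ReciprocityData F, ∀ n : ℕ, 0 < n → ∀ hcpt : Literature.NumberTheory.Automorphic.isCompact_glFiniteIntegralLevel n F, GlobalLanglandsCorrespondenceGLn n F R hcpt) → ∀ (F : Type) [Field F] [NumberField F], (∃ (F₀ E : Type) (_ : Field F₀) (_ : NumberField F₀) (_ : Field E) (_ : NumberField E) (_ : Algebra F₀ F) (_ : Algebra F E) (_ : Algebra F₀ E) (_ : IsScalarTower F₀ F E) (_ : IsGalois F₀ E), NumberField.IsTotallyReal F₀ ∧ IsSolvable (E ≃ₐ[F₀] E)) → ∃ R : ReciprocityData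 F, ∀ n : ℕ, 0 < n → ∀ hcpt : Literature.NumberTheory.Automorphic.isCompact_glFiniteIntegralLevel n F, GlobalLanglandsCorrespondenceGLn n F R hcpt

/-- item stmt-Langlands-1095 · crux · rank 4 · open · by planner
why it might fail: Needs GL_n BC/AI/descent along simple non-abelian Galois layers: no trace-formula comparison exists (GetzHahn2024 §13.4 'unavailable'; Getz2012 conditional, SL₂(𝔽₅) only); Galois-theoretic insoluble BC (Dieulefait2012) needs a TR/CM top field, excluded here; may be no easier than the summit.
sources: Getz2012Nonsolvable Thms 1.1-1.8 (arXiv:1701.01766), GetzHahn2024 §13.4 p.259 (PDF p.275), §13.5, Dieulefait2012 Thm. 1.1, Kim2004, Calegari2023 §12, LanglandsBaseChange1980 §3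
[crux] Reciprocity over all conjugation-solvable fields ⇒ reciprocity over ALL number fields. The
residual class ([F:F^tr] ≥ 5 with insoluble conjugation-closure, e.g. an S₅-quintic with complex
places) is one functoriality away (card T_β): base change + automorphic induction + descent for GL_n
along Galois extensions with SIMPLE non-abelian group (every finite group has a subnormal series
with cyclic or simple factors), then the same bookkeeping as AscentConjugationSolvable. Typed as the
bare implication; the functoriality hypotheses become separate items once a Literature predicate for
non-cyclic base change / automorphic induction exists (definition request filed with this route). -/
@[route_item "route-Langlands-BaseFieldAscent", crux]
def AscentResidual : Prop :=
  (∀ (F : Type) [Field F] [NumberField F], (∃ (F₀ E : Type) (_ : Field F₀) (_ : NumberField F₀) (_ : Field E) (_ : NumberField E) (_ : Algebra F₀ F) (_ : Algebra F E) (_ : Algebra F₀ E) (_ : IsScalarTower F₀ F E) (_ : IsGalois F₀ E), NumberField.IsTotallyReal F₀ ∧ IsSolvable (E ≃ₐ[F₀] E)) → ∃ R : ReciprocityData F, ∀ n : ℕ, 0 < n → ∀ hcpt : Literature.NumberTheory.Automorphic.isCompact_glFiniteIntegralLevel n F, GlobalLanglandsCorrespondenceGLn n F R hcpt) → ∀ (F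 : Type) [Field F] [NumberField F], ∃ R : ReciprocityData F, ∀ n : ℕ, 0 < n → ∀ hcpt : Literature.NumberTheory.Automorphic.isCompact_glFiniteIntegralLevel n F, GlobalLanglandsCorrespondenceGLn n F R hcpt

/-- item stmt-Langlands-18032 · support · rank 5 · open · by planner
[crux] ARTHUR–CLOZEL CUSPIDAL DESCENT OF PRIME DEGREE (route-choice 046b9f1f, 2026-08-17: PROMOTION
of the XL-apex Literature fact `Literature.NumberTheory.Automorphic.cuspidal_descent_cyclic`,
VERBATIM with its two predicates IsGaloisStableSatakeAE / IsWeakBaseChangeLiftAE unfolded —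
`Iff.rfl` against the fact, planner SketchIff.lean rc 0). For E/F cyclic of prime degree and a
cuspidal Π on GL_n(𝔸_E) (Borel–Jacquet datum CuspidalAutomorphicRepData) whose Satake data are
Gal(E/F)-stable a.e. (IsGaloisStableSatakeAE, the shadow of Π ≅ Π∘σ, equivalent to it by strong
multiplicity one) there is a cuspidal π on GL_n(𝔸_F) of which Π is a weak base-change lift
(IsWeakBaseChangeLiftAE: t_{Π,w} = t_{π,v}^{f(w|v)} a.e.). Arthur–Clozel 1989 Ch. 3 Thm 4.2 (d),
existence clause (held copy chunk 173; proof chunk 177: 'the identity of (4.1) with (4.2) shows the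
existence' = the twisted trace formula comparison, Ch. 2 Thms A–B; no L-function proof of descent is
known). LOAD-BEARING HERE: (i) crux #2 ReciprocityTRCM, line `pieces` (lead
prover-line-stmt-Langlands-1093-0) — conjunct 1 of the registered stub stub_arthurClozelDescentFacts
and hypothesis 1 of the LANDED stubs stub_quadraticDescentLAlg -/
@[route_item "route-Langlands-BaseFieldAscent"]
def ArthurClozelCuspidalDescent : Prop :=
  ∀ (n : ℕ) (F E : Type) [Field F] [NumberField F] [Field E] [NumberField E] [Algebra F E] [IsGalois F E] (hF : Literature.NumberTheory.Automorphic.isCompact_glFiniteIntegralLevel n F) (hE : Literature.NumberTheory.Automorphic.isCompact_glFiniteIntegralLevel n E), IsCyclic (E ≃ₐ[F] E) → (Module.finrank F E).Prime → ∀ P : Literature.NumberTheory.Automorphic.CuspidalAutomorphicRepData n E hE, (∀ᶠ w : IsDedekindDomain.HeightOneSpectrum (NumberField.RingOfIntegers E) in Filter.cofinite, ∀ w' : IsDedekindDomain.HeightOneSpectrum (NumberField.RingOfIntegers E), w'.asIdeal.under (NumberField.RingOfIntegers F) = w.asIdeal.under (NumberField.RingOfIntegers F) → ∀ α : Multiset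 ℂ, P.1.HasSatakeParamAt w α → P.1.HasSatakeParamAt w' α) → ∃ π : Literature.NumberTheory.Automorphic.CuspidalAutomorphicRepData n F hF, ∀ᶠ w : IsDedekindDomain.HeightOneSpectrum (NumberField.RingOfIntegers E) in Filter.cofinite, ∀ (v : IsDedekindDomain.HeightOneSpectrum (NumberField.RingOfIntegers F)) (α : Multiset ℂ), w.asIdeal.under (NumberField.RingOfIntegers F) = v.asIdeal → π.1.HasSatakeParamAt v α → P.1.HasSatakeParamAt w (α.map (· ^ w.asIdeal.inertiaDeg (NumberField.RingOfIntegers F)))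

/-- item stmt-Langlands-18033 · support · rank 5 · open · by planner
[crux] Independence of the reciprocity datum (route-repair after the statement re-type p141787 /
D-0032): for a number field F and ANY two reciprocity data R, R' : ReciprocityData F (both pinned:
`llc_isCanonical`, `llc_eps_isCanonical`; `ReciprocityData.pst` ignores the datum), reciprocity for
GL_n/F relative to R implies reciprocity relative to R'. R enters `GlobalLanglandsCorrespondenceGLn`
only through `(R.llc v).recGL n` evaluated at classes of local components of cuspidal π (generic
classes), so the content is Henniart's characterisation/uniqueness of the local Langlands
correspondence (Henniart1993 Thm 1.1; HarrisTaylorAMS2001 Thm A; HenniartInventiones2000) IN THE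
TREE'S TYPING (`IsLocalLanglandsGL` (i)–(iii) with the pinned Artin map and ε-system) plus a
transport lemma through `LocalGlobalCompatibleAt`. It is a consequence of the summit (`Langlands →
DatumRigidity`, Sketch.lean) and the fourth binder of `closes`, upgrading the `∃ R` pieces to
`Nonempty ∧ ∀ 𝓡` (RepairSketch (ii) of the crux-strategist,
Cruxes/ReciprocityTRCM/RepairSketch.lean). If FALSE as typed, the ∀𝓡 summit itself is refutable —
report needs-human. WHY IT MIGHT FAIL: `IsLocalLanglandsGL` (i)–(iii) may u -/
@[route_item "route-Langlands-BaseFieldAscent"]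
def DatumRigidity : Prop :=
  ∀ (F : Type) [Field F] [NumberField F] (R R' : ReciprocityData F) (n : ℕ), 0 < n → ∀ hcpt : Literature.NumberTheory.Automorphic.isCompact_glFiniteIntegralLevel n F, GlobalLanglandsCorrespondenceGLn n F R hcpt → GlobalLanglandsCorrespondenceGLn n F R' hcpt

/-- item stmt-Langlands-19599 · support · rank 5 · open · by planner
[crux] ARTHUR–CLOZEL CUSPIDAL BASE CHANGE OF PRIME DEGREE (route-choice rchoice 2f2042a4,
2026-08-17: PROMOTION of the XL-apex Literature fact
`Literature.NumberTheory.Automorphic.baseChange_cyclic_cuspidal`, VERBATIM and fully qualified,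
`IsWeakBaseChangeLiftAE` unfolded by its Iff.rfl lemma — Iff.rfl against the fact, planner
SketchIff.lean rc 0, #h21_crux_probe CLEAN). For E/F Galois of PRIME degree l (hence cyclic) and a
cuspidal π on GL_n(𝔸_F) with ONE place v inert in E (w ∣ v of residue degree l) and a Satake
parameter α at v with ζ•α ≠ α for every primitive l-th root of unity ζ (local shadow of the printed
π ≇ π⊗η: t_{π⊗η,v} = η(ϖ_v)·t_{π,v}, η(ϖ_v) primitive at inert v, AC proof of Thm 3.1) there is, for
every level datum hE, a CUSPIDAL P on GL_n(𝔸_E) which is a weak base-change lift of π (t_{P,w} =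
t_{π,v}^{f(w|v)} a.e.). Arthur–Clozel 1989 Ch. 3 Thm 4.2 (a) with Def. 1.1 (held copy p0173 L13–15:
'(a) Assume π is cuspidal, π ≢ π⊗η. Then there is a unique σ-stable Π lifting π; Π is cuspidal';
proof p0174 L25–p0176 = twisted trace formula comparison (4.1)=(4.2); n = 2 is Langlands 1980).
LOAD-BEARING HERE: the UP-step of crux AscentConjugationSolvable (stmt-Langlands-1094; -/
@[route_item "route-Langlands-BaseFieldAscent"]
def ArthurClozelCuspidalBaseChange : Prop :=
  ∀ (n : ℕ) (F E : Type) [Field F] [NumberField F] [Field E] [NumberField E] [Algebra F E] [IsGalois F E], (Module.finrank F E).Prime → ∀ (hF : Literature.NumberTheory.Automorphic.isCompact_glFiniteIntegralLevel n F) (π : Literature.NumberTheory.Automorphic.CuspidalAutomorphicRepData n F hF), (∃ (v : IsDedekindDomain.HeightOneSpectrum (NumberField.RingOfIntegers F)) (w : IsDedekindDomain.HeightOneSpectrum (NumberField.RingOfIntegers E)) (α : Multiset ℂ), w.asIdeal.under (NumberField.RingOfIntegers F) = v.asIdeal ∧ w.asIdeal.inertiaDeg (NumberField.RingOfIntegers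 F) = Module.finrank F E ∧ π.1.HasSatakeParamAt v α ∧ ∀ ζ : ℂ, IsPrimitiveRoot ζ (Module.finrank F E) → α.map (ζ * ·) ≠ α) → ∀ (hE : Literature.NumberTheory.Automorphic.isCompact_glFiniteIntegralLevel n E), ∃ P : Literature.NumberTheory.Automorphic.CuspidalAutomorphicRepData n E hE, ∀ᶠ w : IsDedekindDomain.HeightOneSpectrum (NumberField.RingOfIntegers E) in Filter.cofinite, ∀ (v : IsDedekindDomain.HeightOneSpectrum (NumberField.RingOfIntegers F)) (α : Multiset ℂ), w.asIdeal.under (NumberField.RingOfIntegers F) = v.asIdeal → π.1.HasSatakeParamAt v α → P.1.HasSatakeParamAt w (α.map (· ^ w.asIdeal.inertiaDeg (NumberField.RingOfIntegers F)))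

/-- item stmt-Langlands-1096 · support · rank 9 · open · by planner
sources: Sorensen2020, ArthurClozelAMS120, BarnetlambEtAl2014
[support] Reciprocity over all CM fields ⇒ over all totally real fields: (A) by Sorensen patching
over the S-general family of imaginary-quadratic composita FK_i (π ↦ BC_{FK_i/F}(π) cuspidal for all
but finitely many K_i; ρ_i from (A) over FK_i; tree PatchingLemma/SorensenPatching; LGC and de
Rhamness transferred from a K_i splitting v); (B) by quadratic descent of automorphy given (A) over
F (choose K with ρ|_{FK} irreducible — all but finitely many — then Π^c≅Π ⇒ Π = BC(π) by
Arthur–Clozel ⇒ ρ ≅ ρ_π⊗χ). Theorem-level; shared with route CMFern. -/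
@[route_item "route-Langlands-BaseFieldAscent"]
def ReciprocityCMtoTR : Prop :=
  (∀ (F : Type) [Field F] [NumberField F], NumberField.IsCMField F → ∃ R : ReciprocityData F, ∀ n : ℕ, 0 < n → ∀ hcpt : Literature.NumberTheory.Automorphic.isCompact_glFiniteIntegralLevel n F, GlobalLanglandsCorrespondenceGLn n F R hcpt) → ∀ (F : Type) [Field F] [NumberField F], NumberField.IsTotallyReal F → ∃ R : ReciprocityData F, ∀ n : ℕ, 0 < n → ∀ hcpt : Literature.NumberTheory.Automorphic.isCompact_glFiniteIntegralLevel n F, GlobalLanglandsCorrespondenceGLn n F R hcpt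

/-- item stmt-Langlands-1097 · support · rank 9 · open · by planner
sources: Taylor1994, BoxerEtAl2021, ArthurClozelAMS120, HarrisSoudryTaylor1993
[support] First UP-rung in every rank: (A) over a totally real F₀ in all weights ⇒ (A) over every
quadratic extension F/F₀ (CM or mixed signature): AI_{F/F₀}(π⊗χ) for finite-order Hecke characters χ
of F (Arthur–Clozel), Galois representations over F₀ (irregular weight when weights collide at
swapped places — the hypothesis supplies them), de-induction by Clifford theory + matching over a
Zariski-dense family of twists (Taylor1994; Berger–Harcos; Mok Compositio 150 §5; BCGP §2.7
'essentially the same proof' for any quadratic K/F, n=2). General n: the re-partition ambiguity at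
split places (Eig ρ₁(Frob_v) ⊎ Eig ρ₁(Frob_σv) = Sat(π_v) ⊎ Sat(π_σv) as 2n-multisets) is killed by
twists with χ_v ≠ χ_σv; LGC everywhere over F from LGC over F₀ at split/inert places. To be written
carefully; may split under AscentConjugationSolvable in tenure. -/
@[route_item "route-Langlands-BaseFieldAscent"]
def QuadraticAscentAutToGal : Prop :=
  ∀ (F₀ F : Type) [Field F₀] [NumberField F₀] [Field F] [NumberField F] [Algebra F₀ F], NumberField.IsTotallyReal F₀ → Module.finrank F₀ F = 2 → (∃ R₀ : ReciprocityData F₀, ∀ n : ℕ, 0 < n → ∀ hcpt : Literature.NumberTheory.Automorphic.isCompact_glFiniteIntegralLevel n F₀, AutomorphicToGalois n R₀ hcpt) → ∃ R : ReciprocityData F, ∀ n : ℕ, 0 < n → ∀ hcpt : Literature.NumberTheory.Automorphic.isCompact_glFiniteIntegralLevel n F, AutomorphicToGalois n R hcpt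

/-- item stmt-Langlands-18101 · support · rank 9 · open · by planner
[support] DATUM INDEPENDENCE of the summit's correspondence predicate — the exact price, for this
route, of the statement revision p141787 (2026-08-17: `Langlands := ∀ F, Nonempty (ReciprocityData
F) ∧ ∀ Rec n, 0 < n → ∀ hcpt, GLC n F Rec hcpt`, reciprocity data PINNED to the canonical local
Artin maps by `llc_isCanonical` / `llc_eps_isCanonical`): for every number field F, any two
reciprocity data Rec, Rec′, every n ≥ 1, hcpt, cuspidal π of GL_n(𝔸_F), ℓ, ι : ℚ̄_ℓ ≃ ℂ and framed ρ
: Γ_F → GL_n(ℚ̄_ℓ), `Corresponds Rec ι π ρ → Corresponds Rec′ ι π ρ`. Verbatim (full names, binders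
Rec/Rec′) the `DatumIndependence` of Cruxes/ReciprocityUpToIrreducibilityR/SketchIdeateR1K2.lean
(idea henniart-rigidity-forall-rec, crux stmt-Langlands-17925's PICKED line), where it is DERIVED
sorry-free (`datumIndependence_of_genericRigidity ∘ genericRigidity_of_local`) from HENNIART
RIGIDITY ON GENERIC CLASSES (`LocalGenericRigidity`: two local Langlands data over F_v with
canonical Artin pins agree on every generic class — Henniart1993 Thm 1.1 = the tree's named fact
localLanglands_gl, uniqueness half, on supercuspidals, + localEpsilonSystem_unique
(DeligneAntwerpII1973 Thm 4.1) + Henniart2002 Thm 1.7/ -/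
@[route_item "route-Langlands-BaseFieldAscent"]
def DatumIndependence : Prop :=
  ∀ (F : Type) [Field F] [NumberField F] (Rec Rec' : ReciprocityData F) (n : ℕ), 0 < n → ∀ (hcpt : Literature.NumberTheory.Automorphic.isCompact_glFiniteIntegralLevel n F) (π : Literature.NumberTheory.Automorphic.CuspidalAutomorphicRepData n F hcpt) (ℓ : ℕ) [Fact ℓ.Prime] (ι : PadicAlgCl ℓ ≃+* ℂ) (ρ : Literature.NumberTheory.GaloisRepresentations.FramedGaloisRep F (PadicAlgCl ℓ) n), Corresponds Rec ι π.1 ρ → Corresponds Rec' ι π.1 ρ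

/-- item stmt-Langlands-23603 · support · rank 9 · open · by planner
sources: Henniart1993, HenniartBSMF2002, Shalika1974, HarrisTaylorAMS2001, BuzzardGeeLMS2014
[support] [piece R of the L∤R split; verbatim the registered stub
`…CompatibilityAwayFromLR.Birth.stub_recRigidity`; WEAKER (L∤R forces it: landed
`Theorems/CompatibilityAwayFromLR/Negative/RigidOfCompatibilityAwayFromLR.lean`,
`recGL_eq_of_compatibilityAwayFromLR`); leaf ATTACKABLE closed-mod-print: conclusion of the landed
glue `ReciprocityUpToIrreducibilityR.stub_recRigidityLAlg_of_genericRigidity ∘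
stub_genericRigidity_of_facts` from five local facts (localLanglands_gl, generic preimages, Henniart
2002 Thm 1.7(a) / 1.6(b), invariant measures); critic: CLEARED decomp-langlands-crit-1-g0 0
2026-08-30T01:15:58Z (pub/decomp-langlands/STATUS.md; CRITIC-LEDGER.md row 01:15:58Z)] any two
pinned reciprocity data give the same class rec_v(π_v) to every local component of every L-algebraic
cuspidal π (Henniart's uniqueness of rec_v on generic classes; local components of cusp forms are
generic by Shalika). [difficulty: provable-now] -/
@[route_item "route-Langlands-BaseFieldAscent", crux]
def RecRigidity : Prop :=
  ∀ (K : Type) [Field K] [NumberField K] (Rec Rec' : ReciprocityData K) (n : ℕ) (hcpt : Literature.NumberTheory.Automorphic.isCompact_glFiniteIntegralLevel n K), 0 < n → ∀ (π : Literature.NumberTheory.Automorphic.CuspidalAutomorphicRepData n K hcpt), π.1.IsLAlgebraic → ∀ (v : IsDedekindDomain.HeightOneSpectrum (NumberField.RingOfIntegers K)) (πv : Literature.NumberTheory.Automorphic.SmoothIrrep (Matrix.GeneralLinearGroup (Fin n) (v.adicCompletion K))), π.1.HasLocalComponentAt v πv.ρ → (Rec.llc v).recGL n (Literature.NumberTheory.Automorphic.IrrClass.mk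 πv) = (Rec'.llc v).recGL n (Literature.NumberTheory.Automorphic.IrrClass.mk πv)

/-- item stmt-Langlands-1098 · assembly · rank 1 · open · by planner
sources: BuzzardGeeLMS2014
[assembly] ReciprocityTRCM → AscentConjugationSolvable → AscentResidual → Langlands: two modus
ponens (sketch proof `baseFieldAscent_assembly` compiles in the planner's Sketch.lean). -/
@[route_item "route-Langlands-BaseFieldAscent"]
def Assembly : Prop :=
  ReciprocityTRCM → AscentConjugationSolvable → AscentResidual → Langlands

/-! D-0027 §2.1 — DECIDING THEOREM (planner-authored via `route open/edit --closes-file`; by operator:999:2601352 2026-08-31T07:37:24Z):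
its hypotheses are this route's items and its conclusion the sub-problem Statement (glue_lint), and it elaborates with this file. -/

/-- D-0027 §2.1 deciding theorem of route BaseFieldAscent — REPAIRED 2026-08-31 against the summit as
re-typed 2026-08-16 (`∀ F, Nonempty (ReciprocityData F) ∧ ∀ 𝓡 n, 0 < n → ∀ hcpt, (A) ∧ (B)`; the old text
`h₃ (h₂ h₁)` concluded the `∃ 𝓡` shape and no longer elaborated, L236). Reciprocity over TR ∪ CM fields
(`ReciprocityTRCM`) ascends to conjugation-solvable fields (`AscentConjugationSolvable`) and to all number
fields (`AscentResidual`) — one-datum reciprocity for every `F`, whence `Nonempty (ReciprocityData F)`;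
TRANSFER to EVERY pinned datum along the shared support item `RecRigidity` (= stmt-Langlands-23603: any two
pinned data give the same class to every local component of every L-algebraic cuspidal `π`):
`IsGeometricFramed` and the `v ∣ ℓ` clause read the pinned Fontaine datum (definitional agreement), the
Satake clause is datum-free, and the rec-class clause is rewritten in both directions (so the uniqueness
clause of (A) transfers too). Only Statement-level definitions are unfolded; no new import. The support
items `ReciprocityCMtoTR`, `QuadraticAscentAutToGal` and the bookkeeping `Assembly` are not hypotheses. -/
@[closes "route-Langlands-BaseFieldAscent"] theorem closes (h₁ : ReciprocityTRCM) (h₂ : AscentConjugationSolvable) (h₃ : AscentResidual)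
    (hRR : RecRigidity) : _root_.Langlands := by
  intro F _ _
  obtain ⟨R, hR⟩ := h₃ (h₂ h₁) F
  refine ⟨⟨R⟩, fun Rec n hn hcpt => ?_⟩
  -- TRANSFER from the one datum `R` to the arbitrary pinned datum `Rec` along `RecRigidity`:
  -- `IsGeometricFramed` and the `v ∣ ℓ` clause read the pinned Fontaine datum (`ReciprocityData.pst`
  -- ignores its argument ⇒ definitional agreement), the Satake clause is datum-free, and the one
  -- datum-dependent clause `rℂ.HasFrobSemisimpleClass (rec_v π_v)` is rewritten along `RecRigidity`.
  have hcorrT : ∀ (R₁ R₂ : ReciprocityData F) (ℓ : ℕ) [Fact ℓ.Prime] (ι : PadicAlgCl ℓ ≃+* ℂ)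
      (π : Literature.NumberTheory.Automorphic.CuspidalAutomorphicRepData n F hcpt), π.1.IsLAlgebraic →
      ∀ ρ : Literature.NumberTheory.GaloisRepresentations.FramedGaloisRep F (PadicAlgCl ℓ) n,
        Corresponds R₁ ι π.1 ρ → Corresponds R₂ ι π.1 ρ := by
    intro R₁ R₂ ℓ _ ι π hπ ρ h
    refine ⟨h.1, fun v => ?_⟩
    obtain ⟨πv, r, rℂ, hloc, haway, habove, htrans, hclass⟩ := h.2 v
    refine ⟨πv, r, rℂ, hloc, haway, habove, htrans, ?_⟩
    rw [← hRR F R₁ R₂ n hcpt hn π hπ v πv hloc]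
    exact hclass
  obtain ⟨hA, hB⟩ := hR n hn hcpt
  refine ⟨?_, ?_⟩
  · -- (A) for `Rec`
    intro π hπ ℓ _ ι
    obtain ⟨ρ, hirr, hgeo, hcorr, huniq⟩ := hA π hπ ℓ ι
    exact ⟨ρ, hirr, hgeo, hcorrT R Rec ℓ ι π hπ ρ hcorr,
      fun ρ' h' => huniq ρ' (hcorrT Rec R ℓ ι π hπ ρ' h')⟩
  · -- (B) for `Rec`
    intro ℓ _ ι ρ hirr hgeo
    obtain ⟨π, hπ, hcorr⟩ := hB ℓ ι ρ hirr hgeo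
    exact ⟨π, hπ, hcorrT R Rec ℓ ι π hπ ρ hcorr⟩

end Summit.Langlands.Langlands.Theses.BaseFieldAscent
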